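import Literature.Combinatorics.Optimization.ShellLawCentredMomentMainByType
import HarnessLib

/-!
# The first level difference of the centred second moment of `n_A` given the block statistic, on the ground set of a
# perfect matching: the `k = 1` term of the centred-basis criterion, modulo the variance floor and the first-moment drift

Assembly of `ShellLawCentredMomentMainBound.abs_levelStep_centredSecond_le` (the `k = 1` term in conditional form) with
`ShellLawCentredMomentMainByType.mainSmoothness_of_type` (its per-pair `x`-smoothness hypotheses discharged by the type margins and
the window) for the ground set `univ` of a fixed-point-free involution `π` on `Fin n` (`n = 2N₀`), a block `H` of type `(a,b,d)`,
base level `1`, cut `2r+7`, a point `x ≥ 1` in the window `|x − (2r+7)(2a+b)/(2N₀)| ≤ ε`, a real centring `m`: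

* **`abs_centredSecond_three_sub_one_le`**:
  `|A^m_3(x) − A^m_1(x)| ≤ (#pairs/(n(n−2)))·[E·R·(A^m_1(x) + (θ₂−1)F²_1(x) + (θ₁−1)|1−2m|F¹_1(x)) + (W̄₁ + (θ₂−1)W̄₂ + (θ₁−1)|1−2m|W̄₃)·Far]
     + (4/(2r+2))·A^m_1(x) + |2m−1|·(2(2r+6)/((2r+4)(2r+2)))·|B^m_3(x)| + (|2m(4m−2r−6)|/((2r+4)(2r+2)))·law_3(x)`,
  `A^m_c(x) = E_{univ,2r+7,c}[1_{X=x}(n_A−m)²]`, `B^m_c`, `F²_c = E[1_x n_A(n_A−1)]`, `F¹_c = E[1_x n_A]`, `θ₂ = (2r+6)/(2r+2)`,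
  `θ₁ = (2r+6)/(2r+4)`, `R = n(n−2)/((2r+6)(n−2r−8))`, `W̄ = ((r+2+|m|)², (r+2)², r+2)`, `E ≥ E₁(N₀−2, L, ε+15, β)` and
  `Far ≥ 4e^{−(L−2)²/(4(N₀−2))}` the level-`1` constants of `ShellLawBulkSmoothness`, `#pairs = |vAA||vDD| + Σ_{p∈vBH}(|vBN|−1)`.
  (The statement keeps the cut as `2r+1+6`, the levels as `1+2`, and the sections `P₁, P₂, P₃` abstract with their defining
  hypotheses, exactly as produced by the two inputs.)

With the centring `m = E_1[n_A | X = x]` (`B^m_1(x) = 0`), `B^m_3 = Δ_cB^m(1)` is one level difference of the centred FIRST moment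
(Summits brick 133, termwise), and the variance floor (V) `A^m_1(x) ≥ c_V·law_1(x)` (lit: `centredSq_section_ge_of_brackets`)
turns the right side into `ε₁·A^m_1(x)` with `ε₁ → 0` in the cell's regime — the `k = 1` term of input (ii) of the γ-direction
criterion; orders `k ≥ 2` are Summits brick 135 (termwise). All PROVED, 0 sorry, no definitions, no named facts; constants crude and
asymptotic only. Cell pnp-psdrank (prover g27, MEMO-30). Nothing here is about psd rank or P vs NP.

## References
* [RollinRoss2010] A. Röllin, N. Ross, *Local limit theorems via Landau–Kolmogorov inequalities*, Bernoulli 21 (2015)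
  851–880, §3 Lemma 3.3, §4.1 Thm 4.2.
* [Rothvoss2017] T. Rothvoß, *The matching polytope has exponential extension complexity*, J. ACM 64 (2017), §2
  (PDF pp. 5–6).
* [Durrett2019] R. Durrett, *Probability: Theory and Examples*, 5th ed. (2019), §2.7 (Chernoff).
-/

noncomputable section

open Finset

namespace Literature.Combinatorics.Optimization

namespace ShellStep

variable {n : ℕ} {π : Fin n → Fin n}

section FirstOrder

variable (hπ : ∀ v, π (π v) = v) (hπ' : ∀ v, π v ≠ v)
include hπ hπ'

/-- **THE `k = 1` TERM OF THE CENTRED SECOND MOMENT ON THE GROUND SET OF A MATCHING** (see the module docstring for the reading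
of the right-hand side; `S = univ`, `t₀ = 2r+1`, `c₀ = 1` in `abs_levelStep_centredSecond_le`, the per-pair numbers from
`mainSmoothness_of_type`). [cite: RollinRoss2010, §3 (Lemma 3.3), §4.1 Thm 4.2] [cite: Rothvoss2017, §2 (PDF p. 6)]
[cite: Durrett2019, §2.7] -/
theorem abs_centredSecond_three_sub_one_le (H : Finset (Fin n)) {a b d N₀ : ℕ} (ha : (reps π (vAA π univ H)).card = a)
    (hb : (reps π (vBH π univ H ∪ vBN π univ H)).card = b) (hd : (reps π (vDD π univ H)).card = d)
    (hN : a + b + d = N₀)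
    {β : ℝ} (hβ : 0 < β) (hβ1 : β ≤ 1) (hbβ : β * N₀ + 3 ≤ b) (hdβ : β * N₀ + 3 ≤ d)
    {r : ℕ} (hs : β * N₀ ≤ (r : ℝ) + 2) (hs' : 8 * ((r : ℝ) + 2) ≤ (4 + β) * ((N₀ : ℝ) - 2)) (hrN : r + 4 ≤ N₀)
    (hN16 : 16 ≤ N₀) (hne : (shellIn π (univ : Finset (Fin n)) (2 * r + 1 + 6) (1 + 2)).Nonempty)
    {x : ℕ} (hx1 : 1 ≤ x) {ε : ℝ}
    (hxε : |(x : ℝ) - (2 * ((r : ℝ) + 3) + 1) * (2 * a + b) / (2 * N₀)| ≤ ε)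
    {L : ℝ} (h2L : 2 ≤ L) (hLN : L - 2 ≤ 2 * ((N₀ : ℝ) - 2))
    (hL1 : L + 1 + (ε + 15) ≤ β * ((r : ℝ) + 2)) (hL2 : L + 1 + (ε + 15) + 3 ≤ β * ((N₀ : ℝ) - 2) / 8)
    (hwin : 2 * (L + 1 + 1) ≤ (β ^ 2 / 8) ^ 2 * (β * ((N₀ : ℝ) - 2))) (hN4 : 4 ≤ β * ((N₀ : ℝ) - 2))
    (hkV : (1 : ℝ) * (1 + 8 * (L + 1 + 1) / ((β ^ 2 / 8) ^ 4 * (β * ((N₀ : ℝ) - 2)))) ≤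
      (β ^ 2 / 8) ^ 4 * (β * ((N₀ : ℝ) - 2)))
    (m : ℝ) (P₁ P₂ P₃ : Finset (Fin n) → ℕ → ℤ → ℝ)
    (hP₁ : ∀ T t' y, P₁ T t' y = (∑ U ∈ ((shellIn π T t' 1).filter fun U => ((U ∩ H).card : ℤ) = y),
        (((((reps π (vAA π T H)).filter fun v => v ∈ U ∧ π v ∈ U).card : ℕ) : ℝ) - m) ^ 2) /
        ((shellIn π T t' 1).card : ℝ))
    (hP₂ : ∀ T t' y, P₂ T t' y = (∑ U ∈ ((shellIn π T t' 1).filter fun U => ((U ∩ H).card : ℤ) = y),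
        (((((reps π (vAA π T H)).filter fun v => v ∈ U ∧ π v ∈ U).card : ℕ) : ℝ) *
          (((((reps π (vAA π T H)).filter fun v => v ∈ U ∧ π v ∈ U).card : ℕ) : ℝ) - 1))) /
        ((shellIn π T t' 1).card : ℝ))
    (hP₃ : ∀ T t' y, P₃ T t' y = (∑ U ∈ ((shellIn π T t' 1).filter fun U => ((U ∩ H).card : ℤ) = y),
        ((((reps π (vAA π T H)).filter fun v => v ∈ U ∧ π v ∈ U).card : ℕ) : ℝ)) /
        ((shellIn π T t' 1).card : ℝ))
    {E Far : ℝ} (hE0 : 0 ≤ E) (hFar0 : 0 ≤ Far)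
    (hE : (((1 + 8 * (L + 1 + 1) / ((β ^ 2 / 8) ^ 4 * (β * ((N₀ : ℝ) - 2)))) *
            (8 * (L + 1 + 1) / ((β ^ 2 / 8) ^ 4 * (β * ((N₀ : ℝ) - 2))) +
              2 * Real.sqrt 192 * Real.sqrt (2 * (2 * (1 : ℝ) + 1) *
                (1 + 8 * (L + 1 + 1) / ((β ^ 2 / 8) ^ 4 * (β * ((N₀ : ℝ) - 2)))) /
                  ((β ^ 2 / 8) ^ 4 * (β * ((N₀ : ℝ) - 2)))))) ^ (2 * 1) *
          (1 + 4 * (Real.sqrt ((N₀ : ℝ) - 2) + 1) / 3 *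
            (2 * Real.sqrt 192 * Real.sqrt (2 * (2 * (1 : ℝ) + 1) *
              (1 + 8 * (L + 1 + 1) / ((β ^ 2 / 8) ^ 4 * (β * ((N₀ : ℝ) - 2)))) /
                ((β ^ 2 / 8) ^ 4 * (β * ((N₀ : ℝ) - 2))))))) ≤ E)
    (hFar : (4 : ℝ) ^ 1 * Real.exp (-((L - 2 * 1) ^ 2 / (4 * ((N₀ : ℝ) - 2)))) ≤ Far) :
    abs ((∑ U ∈ ((shellIn π (univ : Finset (Fin n)) (2 * r + 1 + 6) (1 + 2)).filter fun U => ((U ∩ H).card : ℤ) = x),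
          (((((reps π (vAA π univ H)).filter fun v => v ∈ U ∧ π v ∈ U).card : ℕ) : ℝ) - m) ^ 2) /
          ((shellIn π (univ : Finset (Fin n)) (2 * r + 1 + 6) (1 + 2)).card : ℝ) - P₁ univ (2 * r + 1 + 6) x) ≤
      ((((vAA π univ H).card : ℝ) * (vDD π univ H).card +
            ∑ p ∈ vBH π univ H, (((vBN π univ H).erase (π p)).card : ℝ)) /
          (((univ : Finset (Fin n)).card : ℝ) * (((univ : Finset (Fin n)).card : ℝ) - 2))) *
        (E * ((((univ : Finset (Fin n)).card : ℝ) * (((univ : Finset (Fin n)).card : ℝ) - 2)) /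
              (((((2 * r + 1 : ℕ) : ℕ) : ℝ) + 6 - ((1 : ℕ) : ℝ)) *
                (((univ : Finset (Fin n)).card : ℝ) - (((2 * r + 1 : ℕ) : ℕ) + 6) - ((1 : ℕ) : ℝ)))) *
            (P₁ univ (2 * r + 1 + 6) x +
              (((((2 * r + 1 : ℕ) : ℕ) : ℝ) + 6 - ((1 : ℕ) : ℝ)) / ((((2 * r + 1 : ℕ) : ℕ) : ℝ) + 2 - ((1 : ℕ) : ℝ)) - 1) *
                P₂ univ (2 * r + 1 + 6) x +
              (((((2 * r + 1 : ℕ) : ℕ) : ℝ) + 6 - ((1 : ℕ) : ℝ)) / ((((2 * r + 1 : ℕ) : ℕ) : ℝ) + 4 - ((1 : ℕ) : ℝ)) - 1) * abs (1 - 2 * m) *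
                P₃ univ (2 * r + 1 + 6) x) +
          ((((r : ℝ) + 2) + |m|) ^ 2 * Far +
            (((((2 * r + 1 : ℕ) : ℕ) : ℝ) + 6 - ((1 : ℕ) : ℝ)) / ((((2 * r + 1 : ℕ) : ℕ) : ℝ) + 2 - ((1 : ℕ) : ℝ)) - 1) *
              (((r : ℝ) + 2) ^ 2 * Far) +
            (((((2 * r + 1 : ℕ) : ℕ) : ℝ) + 6 - ((1 : ℕ) : ℝ)) / ((((2 * r + 1 : ℕ) : ℕ) : ℝ) + 4 - ((1 : ℕ) : ℝ)) - 1) * abs (1 - 2 * m) *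
              (((r : ℝ) + 2) * Far))) +
      (4 / ((((2 * r + 1 : ℕ) : ℕ) : ℝ) + 2 - ((1 : ℕ) : ℝ))) * P₁ univ (2 * r + 1 + 6) x +
      abs (2 * m - 1) * (2 * ((((2 * r + 1 : ℕ) : ℕ) : ℝ) + 6 - ((1 : ℕ) : ℝ)) /
          (((((2 * r + 1 : ℕ) : ℕ) : ℝ) + 4 - ((1 : ℕ) : ℝ)) * ((((2 * r + 1 : ℕ) : ℕ) : ℝ) + 2 - ((1 : ℕ) : ℝ)))) *
        abs ((∑ U ∈ ((shellIn π (univ : Finset (Fin n)) (2 * r + 1 + 6) (1 + 2)).filter fun U => ((U ∩ H).card : ℤ) = x),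
            (((((reps π (vAA π univ H)).filter fun v => v ∈ U ∧ π v ∈ U).card : ℕ) : ℝ) - m)) /
            ((shellIn π (univ : Finset (Fin n)) (2 * r + 1 + 6) (1 + 2)).card : ℝ)) +
      (abs (2 * m * (4 * m + ((1 : ℕ) : ℝ) - ((2 * r + 1 : ℕ) : ℕ) - 6)) /
          (((((2 * r + 1 : ℕ) : ℕ) : ℝ) + 4 - ((1 : ℕ) : ℝ)) * ((((2 * r + 1 : ℕ) : ℕ) : ℝ) + 2 - ((1 : ℕ) : ℝ)))) *
        shellLaw π univ H (2 * r + 1 + 6) (1 + 2) x := by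
  have hst : ∀ v ∈ (univ : Finset (Fin n)), π v ∈ univ := fun v _ => mem_univ _
  obtain ⟨hXA, hXB⟩ := mainSmoothness_of_type hπ hπ' H ha hb hd hN hβ hβ1 hbβ hdβ hs hs' hrN hN16 hx1 hxε h2L hLN hL1
    hL2 hwin hN4 hkV m P₁ P₂ P₃ hP₁ hP₂ hP₃ hE hFar
  exact abs_levelStep_centredSecond_le hπ hπ' hst H (t₀ := 2 * r + 1) (c₀ := 1) (by omega) hne m x P₁ P₂ P₃ hP₁ hP₂ hP₃
    hE0 (by positivity) (by positivity) (by positivity) hXA hXB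

end FirstOrder

end ShellStep

end Literature.Combinatorics.Optimization

end
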